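import Mathlib
import Summits.CriticalPhenomena.CardyFormulaZ2.Theorems.CardySelfRefinementGradientComparabilityStubDcZeroHalfGeSumPivotal
import Summits.CriticalPhenomena.CardyFormulaZ2.Theorems.CardySelfRefinementGradientComparabilityStubNonAxialShareBulk
import Summits.CriticalPhenomena.CardyFormulaZ2.Theorems.CardySelfRefinementGradientComparabilityStubBulkPivotalSumDiverges
import HarnessLib

/-!
# Crux `GradientComparability` (stmt-CriticalPhenomena-10269), line `Sketch` — clause (ii) at the
# Bernoulli endpoint `(0,½)`, PROVED: the Russo-gradient size of the own-coin model diverges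

Route `CardySelfRefinement`, sub-problem `CriticalPhenomena/CardyFormulaZ2`; vocabulary from
`CardySelfRefinementDefs` (`Dρ`, `Dc`, `Aloc`, `window`, `edgeOf`, `ax`).

* `pivotalSum_diverges` — for `k ∈ {2,3}` and every nonempty finite quad family, the expected number
  of NON-axial edges (off the lines of `kℤ²`) pivotal for the joint crossing event under `P_{1/2}`
  on `ℤ²` tends to `+∞` as the mesh `η → 0⁺`: bulk divergence (`stub_bulkPivotalSum_diverges`,
  Talagrand–Rossignol on section events given the boundary layer) ⨉ bulk transfer
  (`stub_nonAxialShare_bulk`, local modification in one fine cell).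
* `divergesAt_zero_half` — hence `|∂ρP| + |∂cP| → +∞` at `(ρ,c) = (0,½)` (where `M_k(0,½) = P_{1/2}`
  and `∂cP ≥ Σ_{non-axial} P_{1/2}(pivotal)`, `stub_Dc_zero_half_ge_sum_pivotal`): clause (ii) of the
  crux at one explicit path point, which — given clause (i) — is all clause (ii) needs
  (`GradientComparability_of` in `Cruxes/GradientComparability/Lines/Sketch.lean`).
(Garban–Pete–Schramm 2010 §1 for the statement that the pivotal count of critical crossing events
diverges; Talagrand 1994 / Rossignol 2006 for the inequality.)
-/

noncomputable section

namespace Summit.CriticalPhenomena.CardyFormulaZ2.Theorems.CardySelfRefinement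

open scoped Topology
open Filter Set MeasureTheory
open Literature.Probability.LatticeModels Literature.Probability.Percolation
open Literature.Probability.Percolation.QuadCrossing
open Summit.CriticalPhenomena.CardyFormulaZ2.Theses.CardySelfRefinement

/-- **Clause (ii), bond-`ℤ²` side (proved composition): the NON-axial pivotal count diverges**
(bulk divergence `stub_bulkPivotalSum_diverges` ⨉ bulk transfer `stub_nonAxialShare_bulk`;
adapted from the transfer worker's scratch composition). -/
theorem pivotalSum_diverges :
    ∀ k : ℕ, k = 2 ∨ k = 3 → ∀ (m : ℕ) (F : Fin m → Quad (Set.univ : Set ℂ)), 0 < m →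
      ∀ N : ℝ, ∃ η₁ : ℝ, 0 < η₁ ∧ ∀ η ∈ Set.Ioo 0 η₁, ∃ W : Finset (Sym2 (Site 2)),
        (∀ e ∈ W, ∃ (v : Site 2) (d : Fin 2), e = edgeOf (v, d) ∧ ¬ ax k (v, d)) ∧
        N ≤ ∑ e ∈ W, (bondPercolation (zdGraph 2) half).real {ω | IsPivotal (Aloc m F η) e ω} := by
  intro k hk m F hm N
  obtain ⟨r, hr, hdiv⟩ := stub_bulkPivotalSum_diverges m F hm
  obtain ⟨c₁, η₄, hc₁, hη₄, hshare⟩ := stub_nonAxialShare_bulk k hk m F r hr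
  obtain ⟨η₁, hη₁, hall⟩ := hdiv (N / c₁)
  refine ⟨min η₁ η₄, lt_min hη₁ hη₄, fun η hη => ?_⟩
  have hη1 : η ∈ Set.Ioo 0 η₁ := ⟨hη.1, lt_of_lt_of_le hη.2 (min_le_left _ _)⟩
  have hη4 : η ∈ Set.Ioo 0 η₄ := ⟨hη.1, lt_of_lt_of_le hη.2 (min_le_right _ _)⟩
  have hη0 : η ≠ 0 := hη.1.ne'
  have hfin : {e ∈ window m F η | ∀ x ∈ e, ∀ (i : Fin m) (j : Fin 4),
      ∀ p ∈ (F i).side j, r ≤ dist ((η : ℂ) * squareLatticeEmbedding.z x) p}.Finite :=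
    (window_finite m F hη0).subset (fun e he => he.1)
  set Wb : Finset (Sym2 (Site 2)) := hfin.toFinset with hWbdef
  have hWb : (↑Wb : Set (Sym2 (Site 2))) = {e ∈ window m F η | ∀ x ∈ e, ∀ (i : Fin m) (j : Fin 4),
      ∀ p ∈ (F i).side j, r ≤ dist ((η : ℂ) * squareLatticeEmbedding.z x) p} :=
    Set.Finite.coe_toFinset _
  obtain ⟨W', hW', hge⟩ := hshare η hη4 Wb hWb
  refine ⟨W', hW', ?_⟩
  have h1 := hall η hη1 Wb hWb
  have h2 : N ≤ c₁ * ∑ e ∈ Wb, (bondPercolation (zdGraph 2) half).real {ω | IsPivotal (Aloc m F η) e ω} := by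
    rw [div_le_iff₀ hc₁] at h1; linarith
  linarith


/-- **Clause (ii) at the Bernoulli endpoint `(0,½)`** (composition of the two stubs above): the
gradient size of the own-coin model at `(0,½)` tends to `+∞` as `η → 0⁺`. -/
theorem divergesAt_zero_half :
    ∀ k : ℕ, k = 2 ∨ k = 3 →
      ∀ (m : ℕ) (F : Fin m → Quad (Set.univ : Set ℂ)), 0 < m → ∀ N : ℝ, ∃ η₁ : ℝ, 0 < η₁ ∧
        ∀ η ∈ Set.Ioo 0 η₁,
          N ≤ |Dρ k m F η ((0 : ℝ), (1 / 2 : ℝ))| + |Dc k m F η ((0 : ℝ), (1 / 2 : ℝ))| := by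
  intro k hk m F hm N
  obtain ⟨η₁, hη₁, h⟩ := pivotalSum_diverges k hk m F hm N
  refine ⟨η₁, hη₁, fun η hη => ?_⟩
  obtain ⟨W, hW, hN⟩ := h η hη
  have h1 := stub_Dc_zero_half_ge_sum_pivotal k m F hη.1.ne' W hW
  have h2 : Dc k m F η ((0 : ℝ), (1 / 2 : ℝ)) ≤ |Dc k m F η ((0 : ℝ), (1 / 2 : ℝ))| := le_abs_self _
  have h3 : 0 ≤ |Dρ k m F η ((0 : ℝ), (1 / 2 : ℝ))| := abs_nonneg _
  linarith

end Summit.CriticalPhenomena.CardyFormulaZ2.Theorems.CardySelfRefinement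

end
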